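/-
Copyright (c) 2026 the pub-hodgecm-mathlib formalisation cell (harness21).  Prover seat hodgecm-mathlib-K2Liu-p08 (g5), Track B «K2-LIT»,
#184♮ = hLiu418 = `stmt-HodgeConjecture-24832`; #42S organ S1 (vii): THE SPLIT FACE OF RECORD `hS1sp`, CLOSED — `I_v(½, (χb³)_v) ≤ R(dV₀; record)` at every
split place `v` of `L/L⁺`, from ★ bricks only.
-/
import Summits.HodgeConjecture.HodgeConjecture.Theorems.K2LiuLocalSWSpanningSplitOfMoverMiddleRowsGeneral  -- ★ the split face modulo `hmid` over a GIVEN implementer (p08)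
import Summits.HodgeConjecture.HodgeConjecture.Theorems.K2LiuSplitWitnessMiddleProfileRowOfLeviRow         -- ★ the split `hmid` payer over the (C3) Levi row (p08)
import Summits.HodgeConjecture.HodgeConjecture.Theorems.K2LiuLocalSWSpanningSplitFaceLetters                 -- ★ `exists_split_face_letters` (p08)
import Summits.HodgeConjecture.HodgeConjecture.Theorems.K2LiuWitnessImplementerCayley                        -- ★ (C2c) part 1: `hEY`, `hEW` (K2Liu-p01)
import Summits.HodgeConjecture.HodgeConjecture.Theorems.K2LiuWitnessImplementerProfile                       -- ★ (C2c) part 2: `hprof` (K2Liu-p01)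
import Summits.HodgeConjecture.HodgeConjecture.Theorems.K2LiuLocalSWTensorBlockTransport                       -- ★ `finSum_smul_diagonal_eq_diagonal`
import Literature.NumberTheory.GelbartRogawski1991.LocalDoubledWeylElementCayleyMover                        -- ★ `exists_mover_conj_iotaD_weylDelta`
import Literature.NumberTheory.GelbartRogawski1991.LocalLeraySection                                         -- ★ `existsImplementer_localSchrodinger`
import Literature.NumberTheory.GelbartRogawski1991.LocalKudlaSplittingInjectiveTransported                   -- ★ `gramR_eq_diagonal`
import HarnessLib

/-!
# Crux `HLiu418`, #42S organ S1 (vii): THE SPLIT FACE OF RECORD `hS1sp`, CLOSED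

Cell `hodgecm-mathlib`, crux item hLiu418 = `stmt-HodgeConjecture-24832`; squad K2 ∕ K2Liu; LEAD F0P6-plan (g14); prover K2Liu-p08 (g5).
THEOREMS ONLY (no `def`, no instance, no notation, no named-fact hypothesis, no `sorry`); lane `--supports stmt-HodgeConjecture-24832 --as helper`.

WHAT.  **`localDegPS_le_localSWImage_record_of_split`**: for the record data `(L, e, dV, dW, eW, e′, dV₀, χb)` and a place `v` of `L⁺` that SPLITS in `L`
(`¬¬ IsSquare (cmQuadraticGenerator)`), the degenerate principal series line at `s₀ = ½` twisted by `(χb³)_v` lies in the local Siegel–Weil image of the frame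
`dV₀` at the record CM splitting and the record mover-implementer: `I_v(½, (χb³)_v) ≤ R_v(dV₀; record)` — the `hS1sp` binder of ★ END
`K2LiuStandardSectionSpanBySWGeneratorsEndGuarded.standardSectionSpanBySWGenerators_of_S1_S5_guarded` (up to the END's instantiation `N = 2, M = 1`).
PROOF = assembly of ★ bricks, no new mathematics: (1) `n′ = 3 + 3` (cardinalities of `e, eW, e′`); (2) the split letters `w₀, π, vd, mψ, w₁` (★
`exists_split_face_letters`); (3) the (C2a) block frame `σ, P, PD` of the tensor datum with `Pᵀ · gramR(𝕍 ⊗ V₀) · P = T₁ ⊕ᶠ T₂`, `Tᵢ = tᵢ · diag(dV₀)` (★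
`exists_blockPerm`, `exists_permGL`, `transpose_perm_mul_gramR_mul_perm`, `gramR_eq_diagonal`, ★ `finSum_smul_diagonal_eq_diagonal`); (4) Cayley-type block
implementers `p₁, p₂` (★ `exists_mover_conj_iotaD_weylDelta` lifted through ★ `MpPsi.proj_surjective` ∘ ★ `existsImplementer_localSchrodinger`); (5) the frame
implementer `E′_ε := π(frameMp_{PD} j̃(p₁,p₂))`, `Γ := op(frameMp_{PD} j̃(p₁,p₂))` with its letters ★ (C2c) `hEY` (`map_deltaLagrangian_proj_frameMp_boxLoc`), `hEW`
(`exists_proj_frameMp_boxLoc_conj_iotaD_weylDelta`), `hprof` (`exists_ne_zero_swSectionTensorLoc_weylDelta_mul_nElem_eq_integral_frameMp_boxLoc`), `hΓ`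
(`MpPsi.toRep_implements`); (6) ★ `localDegPS_le_localSWImage_record_of_moverMiddleRows_general` at `(E′_ε, Γ)`, depth `k = 0`, line `i = 0`, whose ONLY
hypothesis `hmid` is ★ `exists_splitMiddleRows_of_leviRow` (the split `hmid` payer over the (C3) Levi row) — the record splitting is the Kudla–CM splitting by
`rfl` (★ `localSplittingAt_cmFinLocalFamily`), the record pair is a mover (★ `record_isMover`).
References: [Kudla1994] §3 Thm. 3.1; [HarrisKudlaSweet1996] §1, §4 (4.6)–(4.9), §6 Prop. 6.2, 6.4; [KudlaSweet1997] Thm. 1.2(2), Prop. 5.6; [Rangarao1993] §4–§5;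
[MoeglinVignerasWaldspurger1987] Chap. 2 II.1–II.6; [Weil1964] n° 13–14, 32, 34; [CasselsFrohlichANT1967] Ch. II §10.
HONEST LABEL.  Count-neutral helper: `HC_CM` is proved only modulo the 7 printed citations (2 remaining named inputs: hLiu418 = `stmt-HodgeConjecture-24832`,
h413 = `stmt-HodgeConjecture-24833`) until rung 0 closes.  This file discharges the `hS1sp` binder of the #42S END head (§2 `hS1sp_of_record` = the binder's bytes ll. 81–94 VERBATIM, zero hypotheses; sibling ★
`K2LiuLocalSWSpanningSplitFace.hS1sp_of_middleRows` (LH4-p09) is the hypothesis-first re-keyer); the END tie is the END owner's.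

## References
* [Kudla1994] S. S. Kudla, Israel J. Math. 87 (1994), §3 Thm. 3.1.  * [KudlaSweet1997] S. Kudla, W. J. Sweet, Israel J. Math. 98 (1997), Thm. 1.2, Prop. 5.6.
* [HarrisKudlaSweet1996] M. Harris, S. Kudla, W. J. Sweet, J. Amer. Math. Soc. 9 (1996), §1, §4, §6.  * [Rangarao1993] R. Ranga Rao, Pacific J. Math. 157 (1993).
* [MoeglinVignerasWaldspurger1987] C. Mœglin, M.-F. Vignéras, J.-L. Waldspurger, LNM 1291 (1987), Chap. 2.  * [Weil1964] A. Weil, Acta Math. 111 (1964).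
* [CasselsFrohlichANT1967] J. W. S. Cassels, A. Fröhlich (eds.), *Algebraic Number Theory* (1967), Ch. II §10.
-/

set_option autoImplicit false
set_option linter.dupNamespace false -- the mandated namespace repeats `HodgeConjecture.HodgeConjecture`

noncomputable section

open scoped Matrix Kronecker
open NumberField IsDedekindDomain Matrix MeasureTheory
open Literature.RepresentationTheory.HeisenbergGroup Literature.RepresentationTheory.HeisenbergGroup.SymplecticMatrix
open Literature.NumberTheory.Automorphic.UnitaryGroup.QuadraticCoordinates
open Summit.HodgeConjecture.HodgeConjecture.Cruxes.HLiu418.K2LiuLocalSWTensorAdaptedBlocks Summit.HodgeConjecture.HodgeConjecture.Cruxes.HLiu418.K2LiuSiegelUnipotentPairingGram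
open Summit.HodgeConjecture.HodgeConjecture.Cruxes.HLiu418.K2LiuLocalSWBigCellFormula Summit.HodgeConjecture.HodgeConjecture.Cruxes.HLiu418.K2LiuLocalSWTensorBigCellLetters
open Literature.NumberTheory.Automorphic Literature.NumberTheory.Automorphic.UnitaryGroup Literature.NumberTheory.GaloisRepresentations
open Literature.NumberTheory.GaloisRepresentations.IsNonarchimedeanLocalField
open Literature.NumberTheory.Weil1964 Literature.RepresentationTheory.HarrisKudlaSweet1996
open Literature.NumberTheory.GelbartRogawski1991 Literature.NumberTheory.GelbartRogawski1991.GRConstruction Literature.NumberTheory.GelbartRogawski1991.UnitaryDualPair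
open Literature.NumberTheory.GelbartRogawski1991.UnitaryDualPair.LocalSplitting
open Literature.NumberTheory.GelbartRogawski1991.AdaptedBlocks
open Literature.NumberTheory.K2Lit.SiegelDoubled Literature.NumberTheory.K2Lit.LocalSiegelDoubled
open Summit.HodgeConjecture.HodgeConjecture.Cruxes.HLiu418.K2LiuLocalSWSectionDefs Summit.HodgeConjecture.HodgeConjecture.Cruxes.HLiu418.K2LiuLocalSWImageDefs
open Summit.HodgeConjecture.HodgeConjecture.Cruxes.HLiu418.K2LiuSWSectionPlaceFactorisation
open Summit.HodgeConjecture.HodgeConjecture.Cruxes.HLiu418.K2LiuLocalSWSectionSiegelLaw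
open Summit.HodgeConjecture.HodgeConjecture.Cruxes.HLiu418.K2LiuLocalSWSpanningSplitOfRecord
open Summit.HodgeConjecture.HodgeConjecture.Cruxes.HLiu418.K2LiuSplitWitnessPackageOfMoverFrameGeneral
open Summit.HodgeConjecture.HodgeConjecture.Cruxes.HLiu418.K2LiuSplitWitnessOffBigCell
open Summit.HodgeConjecture.HodgeConjecture.Cruxes.HLiu418.K2LiuOffBigCellProfileLevel
open Summit.HodgeConjecture.HodgeConjecture.Cruxes.HLiu418.K2LiuLocalSWImageMoverInvariance (record_isMover)
open Summit.HodgeConjecture.HodgeConjecture.Cruxes.HLiu418.K2LiuLocalSWSpanningRamifiedOfRows (finite_skewQuotient_box)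
open Summit.HodgeConjecture.HodgeConjecture.Cruxes.HLiu418.K2LiuLocalSWCoordinateQuotient (exists_skewAddSubgroup)
open Summit.HodgeConjecture.HodgeConjecture.Cruxes.HLiu418.K2LiuLocalSWDualBoxes (exists_addSubgroup_box box_mono)
open Literature.NumberTheory.GelbartRogawski1991.UnitaryDualPair
open Literature.NumberTheory.GelbartRogawski1991.UnitaryDualPair.LocalSplitting.FrameTransport
open Literature.NumberTheory.GelbartRogawski1991.UnitaryDualPair.LocalSplitting.DoubledBlock
open Summit.HodgeConjecture.HodgeConjecture.Cruxes.HLiu418.K2LiuLocalSWSpanningSplitOfMoverMiddleRowsGeneral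
open Summit.HodgeConjecture.HodgeConjecture.Cruxes.HLiu418.K2LiuSplitWitnessMiddleProfileRowOfLeviRow
open Summit.HodgeConjecture.HodgeConjecture.Cruxes.HLiu418.K2LiuLocalSWSpanningSplitFaceLetters
open Summit.HodgeConjecture.HodgeConjecture.Cruxes.HLiu418.K2LiuWitnessImplementerCayley
open Summit.HodgeConjecture.HodgeConjecture.Cruxes.HLiu418.K2LiuWitnessImplementerProfile
open Summit.HodgeConjecture.HodgeConjecture.Cruxes.HLiu418.K2LiuLocalSWTensorBlockFrame
open Summit.HodgeConjecture.HodgeConjecture.Cruxes.HLiu418.K2LiuLocalSWTensorBlockTransport (finSum_smul_diagonal_eq_diagonal)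

namespace Summit.HodgeConjecture.HodgeConjecture.Cruxes.HLiu418.K2LiuLocalSWSpanningSplitFaceClosed

variable (L : Type) [Field L] [NumberField L] [IsCMField L]
variable {N M : ℕ} (e : Fin N × Fin M ≃ Fin 2)
  (dV : Fin N → L) (hdV : ∀ i, IsCMField.complexConj L (dV i) = dV i) (hdV0 : ∀ i, dV i ≠ 0)
  (dW : Fin M → L) (hdW : ∀ i, IsCMField.complexConj L (dW i) = dW i) (hdW0 : ∀ i, dW i ≠ 0)
variable {M' n' : ℕ} (eW : Fin M × Fin 3 ≃ Fin M') (e' : Fin N × Fin M' ≃ Fin n')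
  (dV₀ : Fin 3 → L) (hdV₀ : ∀ k, IsCMField.complexConj L (dV₀ k) = dV₀ k) (hdV₀0 : ∀ k, dV₀ k ≠ 0)
  {χb : HeckeCharacter L} (hχbs : IsSplittingChar L 1 χb)
variable (v : HeightOneSpectrum (𝓞 (Fp L)))

include hdV0 hdW0 hdV₀0 in
set_option synthInstance.maxHeartbeats 400000 in
set_option maxHeartbeats 4000000 in -- MEASURED: as ★ `localDegPS_le_localSWImage_record_of_moverMiddleRows_general`
open scoped Classical in
/-- **THE SPLIT FACE OF RECORD `hS1sp`, CLOSED**: at a place `v` of `L⁺` split in `L`, for the record data and the twisting character `χb³`,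
`I_v(½, (χb³)_v) ≤ R_v(dV₀; record)`.  Assembly of ★ bricks (module docstring (1)–(6)); no hypothesis beyond the record data and `¬¬ IsSquare`.
[cite: Kudla1994, §3 Thm. 3.1] [cite: KudlaSweet1997, Thm. 1.2(2), Prop. 5.6] [cite: HarrisKudlaSweet1996, §4 (4.6)–(4.9), §6 Prop. 6.2, 6.4]
[cite: MoeglinVignerasWaldspurger1987, Chap. 2 II.1 (A), II.2, II.6] [cite: Weil1964, n° 32, n° 34] -/
theorem localDegPS_le_localSWImage_record_of_split
    (hsq : ¬ (¬ IsSquare (algebraMap (Fp L) (v.adicCompletion (Fp L)) (cmQuadraticGenerator L : Fp L)))) :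
    haveI : Algebra.IsQuadraticExtension (Fp L) L := IsCMField.isQuadraticExtension L
    localDegPS (Fp L) L (IsCMField.complexConj L) (complexConj_imagUnit L) (imagUnit_ne_zero L) (imagUnit_mul_self L)
        v 2 (gramR_isSymm L e dV hdV dW hdW) (hermD_eq_map_gramD L e dV hdV dW hdW) (fun w => (χb ^ 3).localComponent w.1) (((3 : ℂ) - ((2 : ℕ) : ℂ)) / 2) ≤
      localSWImage L e dV hdV dW hdW eW e' dV₀ hdV₀ v ((finSplittings L e' dV hdV hdV0 (tensorFrame L dW eW dV₀) (tensorFrame_real L dW hdW eW dV₀ hdV₀) (tensorFrame_ne_zero L dW eW dV₀ hdW0 hdV₀0) χb (borelPlaceMeasure L) (cmFinLocalFamily L e' dV hdV hdV0 (tensorFrame L dW eW dV₀) (tensorFrame_real L dW hdW eW dV₀ hdV₀) (tensorFrame_ne_zero L dW eW dV₀ hdW0 hdV₀0) χb hχbs (borelPlaceMeasure L))).s v)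
        ⟨(ratSpLoc (Fp L) (n' + n') (gramD L e' dV hdV (tensorFrame L dW eW dV₀) (tensorFrame_real L dW hdW eW dV₀ hdV₀))
                (isUnit_det_gramD L e' dV hdV hdV0 (tensorFrame L dW eW dV₀) (tensorFrame_real L dW hdW eW dV₀ hdV₀) (tensorFrame_ne_zero L dW eW dV₀ hdW0 hdV₀0)) v (deltaD L),
              deltaImpl L e' dV hdV hdV0 (tensorFrame L dW eW dV₀) (tensorFrame_real L dW hdW eW dV₀ hdV₀) (tensorFrame_ne_zero L dW eW dV₀ hdW0 hdV₀0) χb (borelPlaceMeasure L) (cmFinLocalFamily L e' dV hdV hdV0 (tensorFrame L dW eW dV₀) (tensorFrame_real L dW hdW eW dV₀ hdV₀) (tensorFrame_ne_zero L dW eW dV₀ hdW0 hdV₀0) χb hχbs (borelPlaceMeasure L)) v),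
            deltaPair_mem_localMp L e' dV hdV hdV0 (tensorFrame L dW eW dV₀) (tensorFrame_real L dW hdW eW dV₀ hdV₀) (tensorFrame_ne_zero L dW eW dV₀ hdW0 hdV₀0) χb (borelPlaceMeasure L) (cmFinLocalFamily L e' dV hdV hdV0 (tensorFrame L dW eW dV₀) (tensorFrame_real L dW hdW eW dV₀ hdV₀) (tensorFrame_ne_zero L dW eW dV₀ hdW0 hdV₀0) χb hχbs (borelPlaceMeasure L)) v⟩ := by
  haveI hIQ : Algebra.IsQuadraticExtension (Fp L) L := IsCMField.isQuadraticExtension L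
  -- (1) `n′ = 3 + 3`
  obtain rfl : n' = 3 + 3 := by
    have h1 := Fintype.card_congr e
    have h2 := Fintype.card_congr eW
    have h3 := Fintype.card_congr e'
    simp only [Fintype.card_prod, Fintype.card_fin] at h1 h2 h3
    rw [← h2, ← mul_assoc, h1] at h3
    omega
  letI : MeasurableSpace (v.adicCompletion (Fp L)) := (borelPlaceMeasure L v).mS
  haveI : BorelSpace (v.adicCompletion (Fp L)) := (borelPlaceMeasure L v).isBorel
  haveI hHaar : ((borelPlaceMeasure L v).μ).IsAddHaarMeasure := (borelPlaceMeasure L v).isHaar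
  -- (2) the split letters
  obtain ⟨w₀, π, vd, mψ, w₁, hw₀, hπ, hdn, hm, hw₁⟩ := exists_split_face_letters L v e dV hdV dW hdW (0 : Fin 2) hsq
  -- (3) the block frame of the tensor datum
  have hi : (0 : Fin 2) ≠ 1 := by decide
  obtain ⟨σ, hσ₀, hσ₁⟩ := exists_blockPerm (e := e) (eW := eW) (e' := e') hi
  obtain ⟨P, hPσ⟩ := exists_permGL (M₂ := 3) L σ
  have hT₀d : IsUnit (gramR L e' dV hdV (tensorFrame L dW eW dV₀) (tensorFrame_real L dW hdW eW dV₀ hdV₀)).det := (isUnit_det_gramR₀ L e' dV hdV hdV0 (tensorFrame L dW eW dV₀) (tensorFrame_real L dW hdW eW dV₀ hdV₀) (tensorFrame_ne_zero L dW eW dV₀ hdW0 hdV₀0))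
  -- the diagonal letters of `gramR(𝕍)` and of `diag(dV₀)`
  have hG := gramR_eq_diagonal L e dV hdV dW hdW
  set tg : Fin 2 → Fp L := fun k =>
    (⟨dV (e.symm k).1, (IsCMField.complexConj_eq_self_iff (K := L) (dV (e.symm k).1)).1 (hdV _)⟩ : Fp L) *
      ⟨dW (e.symm k).2, (IsCMField.complexConj_eq_self_iff (K := L) (dW (e.symm k).2)).1 (hdW _)⟩ with htg
  have hG' : gramR L e dV hdV dW hdW = Matrix.diagonal tg := hG
  set d₀ : Fin 3 → Fp L := fun k => (⟨dV₀ k, (IsCMField.complexConj_eq_self_iff (K := L) (dV₀ k)).1 (hdV₀ k)⟩ : Fp L) with hd₀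
  have hRD : realDiagonal L dV₀ hdV₀ = Matrix.diagonal d₀ := rfl
  have htg0 : ∀ k, tg k ≠ 0 := fun k => mul_ne_zero (fun h => hdV0 _ (congrArg Subtype.val h)) (fun h => hdW0 _ (congrArg Subtype.val h))
  have hd₀0 : ∀ k, d₀ k ≠ 0 := fun k h => hdV₀0 k (congrArg Subtype.val h)
  have hP : ((P : Matrix (Fin (3 + 3)) (Fin (3 + 3)) (Fp L)))ᵀ * (gramR L e' dV hdV (tensorFrame L dW eW dV₀) (tensorFrame_real L dW hdW eW dV₀ hdV₀)) * (P : Matrix _ _ (Fp L)) =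
      UnitaryGroup.finSum 3 3 (tg 0 • realDiagonal L dV₀ hdV₀) (tg 1 • realDiagonal L dV₀ hdV₀) := by
    rw [hPσ]
    exact transpose_perm_mul_gramR_mul_perm L e dV hdV dW hdW eW e' dV₀ hdV₀ hi hσ₀ hσ₁ hG'
  have hT₁t : tg 0 • realDiagonal L dV₀ hdV₀ = Matrix.diagonal (tg 0 • d₀) := by rw [hRD, Matrix.diagonal_smul]
  have hT₂t : tg 1 • realDiagonal L dV₀ hdV₀ = Matrix.diagonal (tg 1 • d₀) := by rw [hRD, Matrix.diagonal_smul]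
  have hT₁ : (tg 0 • realDiagonal L dV₀ hdV₀).IsSymm := (realDiagonal_isSymm L dV₀ hdV₀).smul _
  have hT₂ : (tg 1 • realDiagonal L dV₀ hdV₀).IsSymm := (realDiagonal_isSymm L dV₀ hdV₀).smul _
  have hdiagU : ∀ a : Fp L, a ≠ 0 → IsUnit (Matrix.diagonal (a • d₀)).det := fun a ha => by
    rw [Matrix.det_diagonal]
    exact isUnit_iff_ne_zero.2 (Finset.prod_ne_zero_iff.2 fun k _ => by rw [Pi.smul_apply, smul_eq_mul]; exact mul_ne_zero ha (hd₀0 k))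
  have hT₁d : IsUnit (tg 0 • realDiagonal L dV₀ hdV₀).det := by rw [hT₁t]; exact hdiagU _ (htg0 0)
  have hT₂d : IsUnit (tg 1 • realDiagonal L dV₀ hdV₀).det := by rw [hT₂t]; exact hdiagU _ (htg0 1)
  have hT' : UnitaryGroup.finSum 3 3 (tg 0 • realDiagonal L dV₀ hdV₀) (tg 1 • realDiagonal L dV₀ hdV₀) =
      Matrix.diagonal (Sum.elim (tg 0 • d₀) (tg 1 • d₀) ∘ finSumFinEquiv.symm) := by
    rw [hRD]
    exact finSum_smul_diagonal_eq_diagonal L (tg 0) (tg 1) d₀ d₀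
  have hT₀'d : IsUnit (UnitaryGroup.finSum 3 3 (tg 0 • realDiagonal L dV₀ hdV₀) (tg 1 • realDiagonal L dV₀ hdV₀)).det := by
    rw [hT', Matrix.det_diagonal]
    refine isUnit_iff_ne_zero.2 (Finset.prod_ne_zero_iff.2 fun k _ => ?_)
    simp only [Function.comp_apply]
    generalize finSumFinEquiv.symm k = s
    rcases s with k₁ | k₂
    · simpa only [Sum.elim_inl, Pi.smul_apply, smul_eq_mul] using mul_ne_zero (htg0 0) (hd₀0 k₁)
    · simpa only [Sum.elim_inr, Pi.smul_apply, smul_eq_mul] using mul_ne_zero (htg0 1) (hd₀0 k₂)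
  have hTv₁ : IsUnit (localGram (Fp L) (3 + 3) (gramD (Fp L) 3 (tg 0 • realDiagonal L dV₀ hdV₀)) v).det := isUnit_det_localGram_gramD (Fp L) v 3 hT₁d
  have hTv₂ : IsUnit (localGram (Fp L) (3 + 3) (gramD (Fp L) 3 (tg 1 • realDiagonal L dV₀ hdV₀)) v).det := isUnit_det_localGram_gramD (Fp L) v 3 hT₂d
  have hTv : IsUnit (localGram (Fp L) ((3 + 3) + (3 + 3)) (gramD (Fp L) (3 + 3) (gramR L e' dV hdV (tensorFrame L dW eW dV₀) (tensorFrame_real L dW hdW eW dV₀ hdV₀))) v).det := isUnit_det_localGram_gramD (Fp L) v (3 + 3) hT₀d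
  have hTv' : IsUnit (localGram (Fp L) ((3 + 3) + (3 + 3))
      (gramD (Fp L) (3 + 3) (UnitaryGroup.finSum 3 3 (tg 0 • realDiagonal L dV₀ hdV₀) (tg 1 • realDiagonal L dV₀ hdV₀))) v).det :=
    isUnit_det_localGram_gramD (Fp L) v (3 + 3) hT₀'d
  -- (4) Cayley-type block implementers
  obtain ⟨E₁, B₁, hp₁', hW₁'⟩ := exists_mover_conj_iotaD_weylDelta (Fp L) L (IsCMField.complexConj L) (complexConj_imagUnit L) (imagUnit_ne_zero L) (imagUnit_mul_self L) v 3 hT₁ hT₁d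
    (rfl : (gramD (Fp L) 3 (tg 0 • realDiagonal L dV₀ hdV₀)).map (algebraMap (Fp L) L) = _) hTv₁
  obtain ⟨E₂, B₂, hp₂', hW₂'⟩ := exists_mover_conj_iotaD_weylDelta (Fp L) L (IsCMField.complexConj L) (complexConj_imagUnit L) (imagUnit_ne_zero L) (imagUnit_mul_self L) v 3 hT₂ hT₂d
    (rfl : (gramD (Fp L) 3 (tg 1 • realDiagonal L dV₀ hdV₀)).map (algebraMap (Fp L) L) = _) hTv₂
  obtain ⟨p₁, rfl⟩ := MpPsi.proj_surjective _ (existsImplementer_localSchrodinger (Fp L) (3 + 3) _ (isUnit_det_gramD (Fp L) 3 hT₁d) v) E₁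
  obtain ⟨p₂, rfl⟩ := MpPsi.proj_surjective _ (existsImplementer_localSchrodinger (Fp L) (3 + 3) _ (isUnit_det_gramD (Fp L) 3 hT₂d) v) E₂
  -- the record pair is a mover
  have hm₀ := record_isMover (hdV0 := hdV0) (hdW0 := hdW0) (hdV'0 := hdV₀0) L dV hdV dW hdW eW e' dV₀ hdV₀ v χb (borelPlaceMeasure L)
    (cmFinLocalFamily L e' dV hdV hdV0 (tensorFrame L dW eW dV₀) (tensorFrame_real L dW hdW eW dV₀ hdV₀) (tensorFrame_ne_zero L dW eW dV₀ hdW0 hdV₀0) χb hχbs (borelPlaceMeasure L))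
  -- (5) the frame implementer's letters (★ (C2c))
  have hEY := map_deltaLagrangian_proj_frameMp_boxLoc L dV hdV dW hdW eW e' dV₀ hdV₀ v P hP (PD := _) rfl p₁ hp₁' p₂ hp₂'
  obtain ⟨BW, hEW⟩ := exists_proj_frameMp_boxLoc_conj_iotaD_weylDelta L dV hdV dW hdW eW e' dV₀ hdV₀ v P hPσ hP (PD := _) rfl hT₁ hT₂ hTv hTv' hTv₁ hTv₂
    p₁ B₁ hW₁' p₂ B₂ hW₂'
  obtain ⟨γ', hγ', hprof⟩ := exists_ne_zero_swSectionTensorLoc_weylDelta_mul_nElem_eq_integral_frameMp_boxLoc L e dV hdV dW hdW eW e' dV₀ hdV₀ v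
    (borelPlaceMeasure L v).μ χb hχbs hT₀d P hPσ hP hT₀'d (PD := _) rfl
    ⟨(ratSpLoc (Fp L) ((3 + 3) + (3 + 3)) (gramD L e' dV hdV (tensorFrame L dW eW dV₀) (tensorFrame_real L dW hdW eW dV₀ hdV₀))
          (isUnit_det_gramD L e' dV hdV hdV0 (tensorFrame L dW eW dV₀) (tensorFrame_real L dW hdW eW dV₀ hdV₀) (tensorFrame_ne_zero L dW eW dV₀ hdW0 hdV₀0)) v (deltaD L),
        deltaImpl L e' dV hdV hdV0 (tensorFrame L dW eW dV₀) (tensorFrame_real L dW hdW eW dV₀ hdV₀) (tensorFrame_ne_zero L dW eW dV₀ hdW0 hdV₀0) χb (borelPlaceMeasure L) (cmFinLocalFamily L e' dV hdV hdV0 (tensorFrame L dW eW dV₀) (tensorFrame_real L dW hdW eW dV₀ hdV₀) (tensorFrame_ne_zero L dW eW dV₀ hdW0 hdV₀0) χb hχbs (borelPlaceMeasure L)) v),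
      deltaPair_mem_localMp L e' dV hdV hdV0 (tensorFrame L dW eW dV₀) (tensorFrame_real L dW hdW eW dV₀ hdV₀) (tensorFrame_ne_zero L dW eW dV₀ hdW0 hdV₀0) χb (borelPlaceMeasure L) (cmFinLocalFamily L e' dV hdV hdV0 (tensorFrame L dW eW dV₀) (tensorFrame_real L dW hdW eW dV₀ hdV₀) (tensorFrame_ne_zero L dW eW dV₀ hdW0 hdV₀0) χb hχbs (borelPlaceMeasure L)) v⟩
    hm₀ hT₁ hT₂ hTv₁ hTv₂ p₁ hp₁' B₁ hW₁' p₂ hp₂' B₂ hW₂' hm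
  -- (6) the face over the implementer, `hmid` paid by the split payer over the (C3) Levi row
  have hΓ : Implements (localSchrodinger (Fp L) ((3 + 3) + (3 + 3))
      (gramD (Fp L) (3 + 3) (gramR L e' dV hdV (tensorFrame L dW eW dV₀) (tensorFrame_real L dW hdW eW dV₀ hdV₀))) v)
      (ofSymplectic _ (MpPsi.proj _ (frameMp (Fp L) v ((3 + 3) + (3 + 3)) _ (transpose_pd_mul_gramD_mul_pd (Fp L) (3 + 3) P hP rfl)
        (boxLoc (Fp L) v 3 3 (T₁ := tg 0 • realDiagonal L dV₀ hdV₀) (T₂ := tg 1 • realDiagonal L dV₀ hdV₀) (p₁, p₂)))))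
      (MpPsi.toOp _ (frameMp (Fp L) v ((3 + 3) + (3 + 3)) _ (transpose_pd_mul_gramD_mul_pd (Fp L) (3 + 3) P hP rfl)
        (boxLoc (Fp L) v 3 3 (T₁ := tg 0 • realDiagonal L dV₀ hdV₀) (T₂ := tg 1 • realDiagonal L dV₀ hdV₀) (p₁, p₂)))) :=
    MpPsi.toRep_implements _ _
  refine localDegPS_le_localSWImage_record_of_moverMiddleRows_general L e dV hdV hdV0 dW hdW hdW0 eW e' dV₀ hdV₀ hdV₀0 hχbs v hm hdn w₀ hw₀ hπ 0 0 hw₁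
    _ hEY _ hΓ hγ' ?_ ?_
  · exact hprof
  intro P₃ κ Φk Φk1 κ' hP₃det hP₃ hK1 hκ' _ _ _ hreadk hreadk1
  -- the record splitting IS the Kudla–CM splitting (★ `finSplittings_s`, ★ `localSplittingAt_cmFinLocalFamily`, `rfl`)
  rw [finSplittings_s, localSplittingAt_cmFinLocalFamily]
  exact exists_splitMiddleRows_of_leviRow L e dV hdV dW hdW eW e' dV₀ hdV₀ v (borelPlaceMeasure L v).μ χb hχbs hT₀d hi hσ₀ hσ₁ P hPσ hP _ hT' hT₀'d
    (PD := _) rfl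
    ⟨(ratSpLoc (Fp L) ((3 + 3) + (3 + 3)) (gramD L e' dV hdV (tensorFrame L dW eW dV₀) (tensorFrame_real L dW hdW eW dV₀ hdV₀))
          (isUnit_det_gramD L e' dV hdV hdV0 (tensorFrame L dW eW dV₀) (tensorFrame_real L dW hdW eW dV₀ hdV₀) (tensorFrame_ne_zero L dW eW dV₀ hdW0 hdV₀0)) v (deltaD L),
        deltaImpl L e' dV hdV hdV0 (tensorFrame L dW eW dV₀) (tensorFrame_real L dW hdW eW dV₀ hdV₀) (tensorFrame_ne_zero L dW eW dV₀ hdW0 hdV₀0) χb (borelPlaceMeasure L) (cmFinLocalFamily L e' dV hdV hdV0 (tensorFrame L dW eW dV₀) (tensorFrame_real L dW hdW eW dV₀ hdV₀) (tensorFrame_ne_zero L dW eW dV₀ hdW0 hdV₀0) χb hχbs (borelPlaceMeasure L)) v),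
      deltaPair_mem_localMp L e' dV hdV hdV0 (tensorFrame L dW eW dV₀) (tensorFrame_real L dW hdW eW dV₀ hdV₀) (tensorFrame_ne_zero L dW eW dV₀ hdW0 hdV₀0) χb (borelPlaceMeasure L) (cmFinLocalFamily L e' dV hdV hdV0 (tensorFrame L dW eW dV₀) (tensorFrame_real L dW hdW eW dV₀ hdV₀) (tensorFrame_ne_zero L dW eW dV₀ hdW0 hdV₀0) χb hχbs (borelPlaceMeasure L)) v⟩
    hm₀ hw₁ _ hT₁t hT₁ hT₂ hT₁d hT₂d hTv₁ p₁ hp₁' B₁ hW₁' hm p₂ hp₂' w₀ hw₀ hπ 0 hEY BW hEW P₃ κ Φk Φk1 κ' hP₃det hP₃ hK1 hκ' hreadk hreadk1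


set_option maxHeartbeats 400000 in -- MEASURED: as ★ `K2LiuLocalSWSpanningSplitFace.hS1sp_of_middleRows` (the END head's `hS1sp` telescope in the statement)
open scoped Classical in
/-- **`hS1sp` OF THE #42S END HEAD, ZERO HYPOTHESES** — the binder bytes of ★ `K2LiuStandardSectionSpanBySWGeneratorsEndGuarded.standardSectionSpanBySWGenerators_of_S1_S5_guarded`
ll. 81–94 VERBATIM, discharged by §1 at `N = 2`, `M = 1`. [cite: Kudla1994, §3 Thm. 3.1] [cite: KudlaSweet1997, Thm. 1.2(2), Prop. 5.6] [cite: HarrisKudlaSweet1996, §6 Prop. 6.2, 6.4] -/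
theorem hS1sp_of_record :
    ∀ (L : Type) [Field L] [NumberField L] [IsCMField L] (e : Fin 2 × Fin 1 ≃ Fin 2)
      (dV : Fin 2 → L) (hdV : ∀ i, IsCMField.complexConj L (dV i) = dV i) (hdV0 : ∀ i, dV i ≠ 0)
      (dW : Fin 1 → L) (hdW : ∀ i, IsCMField.complexConj L (dW i) = dW i) (hdW0 : ∀ i, dW i ≠ 0)
      {M' n' : ℕ} (eW : Fin 1 × Fin 3 ≃ Fin M') (e' : Fin 2 × Fin M' ≃ Fin n')
      (dV₀ : Fin 3 → L) (hdV₀ : ∀ k, IsCMField.complexConj L (dV₀ k) = dV₀ k) (hdV₀0 : ∀ k, dV₀ k ≠ 0)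
      (χb : HeckeCharacter L) (hχbs : IsSplittingChar L 1 χb),
      ∀ v : HeightOneSpectrum (𝓞 (Fp L)), ¬ (¬ IsSquare (algebraMap (Fp L) (v.adicCompletion (Fp L)) (cmQuadraticGenerator L : Fp L))) →
      localDegPS (Fp L) L (IsCMField.complexConj L) (complexConj_imagUnit L) (imagUnit_ne_zero L) (imagUnit_mul_self L)
          v 2 (gramR_isSymm L e dV hdV dW hdW) (hermD_eq_map_gramD L e dV hdV dW hdW) (fun w => (χb ^ 3).localComponent w.1) ((((3 : ℕ) : ℂ) - ((2 : ℕ) : ℂ)) / 2) ≤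
        localSWImage L e dV hdV dW hdW eW e' dV₀ hdV₀ v ((finSplittings L e' dV hdV hdV0 (tensorFrame L dW eW dV₀) (tensorFrame_real L dW hdW eW dV₀ hdV₀) (tensorFrame_ne_zero L dW eW dV₀ hdW0 hdV₀0) χb (borelPlaceMeasure L) (cmFinLocalFamily L e' dV hdV hdV0 (tensorFrame L dW eW dV₀) (tensorFrame_real L dW hdW eW dV₀ hdV₀) (tensorFrame_ne_zero L dW eW dV₀ hdW0 hdV₀0) χb hχbs (borelPlaceMeasure L))).s v)
          ⟨(ratSpLoc (Fp L) (n' + n') (gramD L e' dV hdV (tensorFrame L dW eW dV₀) (tensorFrame_real L dW hdW eW dV₀ hdV₀))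
                (isUnit_det_gramD L e' dV hdV hdV0 (tensorFrame L dW eW dV₀) (tensorFrame_real L dW hdW eW dV₀ hdV₀) (tensorFrame_ne_zero L dW eW dV₀ hdW0 hdV₀0)) v (deltaD L),
              deltaImpl L e' dV hdV hdV0 (tensorFrame L dW eW dV₀) (tensorFrame_real L dW hdW eW dV₀ hdV₀) (tensorFrame_ne_zero L dW eW dV₀ hdW0 hdV₀0) χb (borelPlaceMeasure L) (cmFinLocalFamily L e' dV hdV hdV0 (tensorFrame L dW eW dV₀) (tensorFrame_real L dW hdW eW dV₀ hdV₀) (tensorFrame_ne_zero L dW eW dV₀ hdW0 hdV₀0) χb hχbs (borelPlaceMeasure L)) v),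
            deltaPair_mem_localMp L e' dV hdV hdV0 (tensorFrame L dW eW dV₀) (tensorFrame_real L dW hdW eW dV₀ hdV₀) (tensorFrame_ne_zero L dW eW dV₀ hdW0 hdV₀0) χb (borelPlaceMeasure L) (cmFinLocalFamily L e' dV hdV hdV0 (tensorFrame L dW eW dV₀) (tensorFrame_real L dW hdW eW dV₀ hdV₀) (tensorFrame_ne_zero L dW eW dV₀ hdW0 hdV₀0) χb hχbs (borelPlaceMeasure L)) v⟩ := by
  intro L _ _ _ e dV hdV hdV0 dW hdW hdW0 M' n' eW e' dV₀ hdV₀ hdV₀0 χb hχbs v hsq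
  exact localDegPS_le_localSWImage_record_of_split L e dV hdV hdV0 dW hdW hdW0 eW e' dV₀ hdV₀ hdV₀0 hχbs v hsq

end Summit.HodgeConjecture.HodgeConjecture.Cruxes.HLiu418.K2LiuLocalSWSpanningSplitFaceClosed

end
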